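/-
Copyright (c) 2026 the pub-hodgecm-mathlib formalisation cell (harness21).  Prover seat hodgecm-mathlib-LH4-p17 (g0), req620 Track A «(D-RAM) FOUR-FRAME» squad, helper lane on
h413 = stmt-HodgeConjecture-24833 (count-neutral).  β-BOARD v1 (sub-dealer LH4-p05 (g8)) row R3 «G₁ ε-BOUNDARY TOWER FILE», FILE 1: the labelled odd count of a CHARACTER LABEL
(the two-slot generalisation of ★ F0P3-p01 (g36) HEAD A `two_mul_labelledOddCount_eq_of_oneSlot`).  2026-09-04.
-/
import Summits.HodgeConjecture.HodgeConjecture.Theorems.F0P3cDyRamLabelledOddClassSignRead   -- ★ p860516 (LH4-p13 (g8)): `classLabelSign_cl_eq_of_classSign`, `two_mul_ite_eq_mul_one_add`; brings ★ g36 `…OneSlotRead` (HEAD A kit), ★ p860257 DEFS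
import HarnessLib

/-!
# Crux `H413`, line LH4 «(D-RAM) FOUR-FRAME» — (β) Stage B, R3 FILE 1 «THE LABELLED ODD COUNT OF A CHARACTER LABEL»
# `m^Λ_i(M₀) ∕ [𝒰 : N(S̃′(M₀))] = ε·ω(D_{1,i})∕2 · [ω_i·λ ≡ 1 on S_F(M₀)] · stabiliserWeight σ M₀`  for `Λ(M₀, D₁·u) = [ε·λ(u) = 1]`, `λ : S_F(M₀) → {±1}` multiplicative, `λ ≡ 1` on `N(S̃′)`

Cell `hodgecm-mathlib` (D-0151), FLOOR 0, crux item H413 = `stmt-HodgeConjecture-24833`, route `HCCMUnconditional`; squad F0∕P3c∕LH4.  THEOREMS ONLY (no `def`, no instance, no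
notation, no `sorry`, default heartbeats); ★-only imports; lane `--supports stmt-HodgeConjecture-24833 --as helper` (count-neutral); pays NO row, states NO law.

WHY (β-BOARD v1 R3∕R4∕R5, the ε-BOUNDARY layers of the glued strata).  ★ g36 HEAD A reads the labelled odd count of a ONE-SLOT label `Λ(M₀, D₁·u) = [ε·ω(u_k) = 1]`.  Beyond the
one-slot cell the value-class label of record on a glued orbit `latt V(1,1,g)` is `ω(u₀·g·g_α + u₁·g_β)` (★ p13 `valueClassLabel_glued_rep_class_iff_normSign`), i.e. `ε·λ(u)` with
`λ(u) = ω(u₁)·ω(1 + c·(u₀∕u₁ − 1))` — NOT one-slot, but still a `{±1}`-valued MULTIPLICATIVE character of `S_F(latt V)` trivial on `N(S̃′)` (the correction `ω(1 + c·ε)` is additive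
on `𝔭^ρ` in the derived regime; sequel file).  This file is ★ g36 HEAD A ∕ A′ with `ω(u_k)` replaced by an abstract such `λ` — the same character-sum proof over `A = S_F ∕ N(S̃′)`:
* §1 HEAD A-χ `two_mul_labelledOddCount_eq_of_character`: `2·m^Λ_i(M₀) = ω(D_{1,i})·|A|·([ω_i ≡ 1 on S_F] + ε·[ω_i·λ ≡ 1 on S_F])`; `…_of_unit` (a unit non-norm kills `[ω_i ≡ 1]`).
* §2 HEAD A′-χ `labelledOddCount_div_relIndex_eq_of_character`: over `ℚ` on a finite unit-torus orbit, `m^Λ_i(M₀) ∕ [𝒰 : N(S̃′)] = ε·ω(D_{1,i})∕2 · [ω_i·λ ≡ 1 on S_F] · stabiliserWeight σ M₀`.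
HONEST LABEL.  Count-neutral bookkeeping; proves no census ((β-BAL)∕(β)∕T₊ OPEN); `HC_CM` is proved only modulo the 7 printed citations (2 remaining named inputs: hLiu418 =
`stmt-HodgeConjecture-24832`, h413 = `stmt-HodgeConjecture-24833`) until rung 0 closes.

## References
* [Kottwitz1986BaseChangeUnits] R. E. Kottwitz, *Base change for unit elements of Hecke algebras*, Compositio Math. 60 (1986), §1 pp. 240–241 (signed lattice counts; stabiliser indices).
* [LanglandsShelstad1987] R. P. Langlands, D. Shelstad, *On the definition of transfer factors*, Math. Ann. 278 (1987), §3 (the characters of `H¹(F, T) = (ℤ∕2)³`).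
* [Serre1979] J.-P. Serre, *Local Fields*, GTM 67 (1979), Ch. V §3 Cor. 3 (norm classes of units), Ch. VI §1 (orthogonality of characters of a finite abelian group).
* [Rogawski1990] J. D. Rogawski, *Automorphic Representations of Unitary Groups in Three Variables*, Ann. of Math. Stud. 123 (1990), §4.9 Prop. 4.9.1 (a)(b) p. 55, §4.10 p. 58.
-/

set_option autoImplicit false

noncomputable section

namespace Summit.HodgeConjecture.HodgeConjecture.Cruxes.H413.F0P3cDyRamLabelledOddCharacterRead

open Literature.NumberTheory.Automorphic Literature.NumberTheory.Automorphic.HermitianLattice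
open Literature.NumberTheory.Automorphic.UnitaryLatticeTree Literature.NumberTheory.Automorphic.UnitaryThreeFourFrame
open Summit.HodgeConjecture.HodgeConjecture.Cruxes.H413.F0P3cDyRamFourFramePieces
open Summit.HodgeConjecture.HodgeConjecture.Cruxes.H413.F0P3cDyRamDiagonalTorusDefs
open Summit.HodgeConjecture.HodgeConjecture.Cruxes.H413.F0P3cDyRamLabelledOddCountDefs
open Summit.HodgeConjecture.HodgeConjecture.Cruxes.H413.F0P3cDyRamDiagonalOrbitAveraging (relIndex_fixedUnitStabilizer_ne_zero_of_finite)
open Summit.HodgeConjecture.HodgeConjecture.Cruxes.H413.F0P3cDyRamDiagonalLabelledOddOrbitCount (relIndex_map_unitNormMap_unitStabilizer_ne_zero)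
open Summit.HodgeConjecture.HodgeConjecture.Cruxes.H413.F0P3cDyRamDiagonalKappaCountEval (normSign_mul_of_dichotomy fixed_of_mem_fixedUnitStabilizer)
open Summit.HodgeConjecture.HodgeConjecture.Cruxes.H413.F0P3cDyRamStableSumSignClasses (normSign_eq_one_or)
open Summit.HodgeConjecture.HodgeConjecture.Cruxes.H413.F0P3cDyRamLabelledOddOneSlotRead
open Summit.HodgeConjecture.HodgeConjecture.Cruxes.H413.F0P3cDyRamLabelledOddClassSignRead (classLabelSign_cl_eq_of_classSign two_mul_ite_eq_mul_one_add)
open scoped Valued WithZero Matrix MatrixGroups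

variable {K : Type} [Field K] [Valued K ℤᵐ⁰]
variable {σ : K →+* K} {ϖ : K} {tv : ℕ} {M₀ : Submodule 𝒪[K] (Fin 3 → K)} {D₁ : Fin 3 → K}

/-! ## §1  HEAD A-χ — the labelled odd count of a character label -/

/-- A `{±1}`-valued multiplicative function on a subgroup takes the value `1` at `1`. [cite: Serre1979, Ch. VI §1] -/
theorem character_one_eq_one {lam : (Fin 3 → Kˣ) → ℤ} (hmul : ∀ u ∈ fixedUnitStabilizer σ M₀, ∀ u' ∈ fixedUnitStabilizer σ M₀, lam (u * u') = lam u * lam u')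
    (hval : ∀ u ∈ fixedUnitStabilizer σ M₀, lam u = 1 ∨ lam u = -1) : lam 1 = 1 := by
  have h := hmul 1 (one_mem _) 1 (one_mem _)
  rw [one_mul] at h
  rcases hval 1 (one_mem _) with h1 | h1
  · exact h1
  · rw [h1] at h; norm_num at h

open Classical in
/-- **HEAD A-χ — THE LABELLED ODD COUNT OF A CHARACTER LABEL.**  Let the type-`tv` polarisations of `M₀` form the coset `D₁·S_F(M₀)` (`hcoset`), `|A| := [S_F(M₀) : N(S̃′(M₀))] ≠ 0`,
`λ : S_F(M₀) → {±1}` multiplicative and `≡ 1` on `N(S̃′(M₀))`, and let `Λ M₀ (D₁·u) ↔ ε·λ(u) = 1` on `S_F(M₀)` (`ε = ±1`).  Then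
`2 · labelledOddCount σ ϖ tv i Λ M₀ = ω(D_{1,i}) · |A| · ([∀ u ∈ S_F, ω(u_i) = 1] + ε · [∀ u ∈ S_F, ω(u_i)·λ(u) = 1])`
(classes ≃ `S_F ∕ N(S̃′)`; signed label of a class `= [ε·λ(u) = 1]·ω(D_{1,i})ω(u_i)` by ★ p13 `classLabelSign_cl_eq_of_classSign`; `[ε·a = 1] = (1 + ε·a)∕2`; character sums over `A` by
Mathlib `sum_hom_units` applied to `ω_i` and `ω_i·λ` descended to `S_F ∕ N(S̃′)`).  ★ g36 HEAD A is the case `λ = ω(u_k)`. [cite: Kottwitz1986BaseChangeUnits, §1 pp. 240–241]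
[cite: LanglandsShelstad1987, §3] [cite: Serre1979, Ch. VI §1] -/
theorem two_mul_labelledOddCount_eq_of_character (hσ : ∀ x, σ (σ x) = x)
    {c : K} (hσc : σ c = c) (hc : ¬ ∃ z : K, z * σ z = c)
    (hdich : ∀ x : K, σ x = x → x ≠ 0 → (∃ z : K, z * σ z = x) ∨ ∃ z : K, z * σ z = c * x)
    (hD₁ : ∀ j, σ (D₁ j) = D₁ j ∧ D₁ j ≠ 0) (hV₁ : IsVertexLattice σ ϖ (Matrix.diagonal D₁) tv M₀)
    (hcoset : ∀ D : Fin 3 → K, (∀ j, σ (D j) = D j ∧ D j ≠ 0) →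
      (IsVertexLattice σ ϖ (Matrix.diagonal D) tv M₀ ↔ ∃ u ∈ fixedUnitStabilizer σ M₀, ∀ j, D j = D₁ j * ((u j : Kˣ) : K)))
    (hA : ((unitStabilizer M₀).map (unitNormMap σ 3)).relIndex (fixedUnitStabilizer σ M₀) ≠ 0)
    (Λ : Submodule 𝒪[K] (Fin 3 → K) → (Fin 3 → K) → Prop) (i : Fin 3) {ε : ℤ} (hε : ε = 1 ∨ ε = -1)
    {lam : (Fin 3 → Kˣ) → ℤ} (hmul : ∀ u ∈ fixedUnitStabilizer σ M₀, ∀ u' ∈ fixedUnitStabilizer σ M₀, lam (u * u') = lam u * lam u')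
    (hval : ∀ u ∈ fixedUnitStabilizer σ M₀, lam u = 1 ∨ lam u = -1)
    (hN : ∀ n ∈ (unitStabilizer M₀).map (unitNormMap σ 3), lam n = 1)
    (hΛ : ∀ u ∈ fixedUnitStabilizer σ M₀, Λ M₀ (fun j => D₁ j * ((u j : Kˣ) : K)) ↔ ε * lam u = 1) :
    2 * labelledOddCount σ ϖ tv i Λ M₀ =
      normSign σ (D₁ i) * ((((unitStabilizer M₀).map (unitNormMap σ 3)).relIndex (fixedUnitStabilizer σ M₀) : ℕ) : ℤ) *
        ((if ∀ u ∈ fixedUnitStabilizer σ M₀, normSign σ ((u i : Kˣ) : K) = 1 then 1 else 0) +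
          ε * (if ∀ u ∈ fixedUnitStabilizer σ M₀, normSign σ ((u i : Kˣ) : K) * lam u = 1 then 1 else 0)) := by
  set S := fixedUnitStabilizer σ M₀ with hSdef
  set N' := (unitStabilizer M₀).map (unitNormMap σ 3) with hN'def
  have hNS : N' ≤ S := map_unitNormMap_unitStabilizer_le σ hσ ϖ tv hD₁ hV₁ hcoset
  have hfixS : ∀ u : S, ∀ j, σ ((u.1 j : Kˣ) : K) = u.1 j ∧ ((u.1 j : Kˣ) : K) ≠ 0 := fun u => fixed_of_mem_fixedUnitStabilizer σ u.2
  -- `ε·λ` is `N′`-invariant and reads the label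
  have hεlamN : ∀ u ∈ fixedUnitStabilizer σ M₀, ∀ n ∈ (unitStabilizer M₀).map (unitNormMap σ 3), ε * lam (u * n) = ε * lam u := fun u hu n hn => by
    rw [hmul u hu n (hNS hn), hN n hn, mul_one]
  have hεval : ∀ u ∈ fixedUnitStabilizer σ M₀, ε * lam u = 1 ∨ ε * lam u = -1 := fun u hu => by
    rcases hε with rfl | rfl <;> rcases hval u hu with h | h <;> rw [h] <;> norm_num
  -- the finite quotient `A = S_F ∕ N′`
  set H : Subgroup S := N'.subgroupOf S with hHdef
  have hHi : H.index = N'.relIndex S := rfl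
  haveI : H.FiniteIndex := ⟨by rw [hHi]; exact hA⟩
  letI : Fintype (S ⧸ H) := Fintype.ofFinite _
  have hcard : (Fintype.card (S ⧸ H) : ℤ) = ((N'.relIndex S : ℕ) : ℤ) := by
    rw [← Nat.card_eq_fintype_card, ← Subgroup.index_eq_card, hHi]
  -- the classes, indexed by `A`
  set cl : S → Set (Fin 3 → K) := fun u =>
    {D' : Fin 3 → K | ∃ n ∈ N', ∀ j, D' j = D₁ j * ((u.1 j : Kˣ) : K) * ((n j : Kˣ) : K)} with hcldef
  have hcl : ∀ u u' : S, cl u = cl u' ↔ u⁻¹ * u' ∈ H := fun u u' => by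
    rw [Subgroup.mem_subgroupOf, Subgroup.coe_mul, Subgroup.coe_inv]; exact cl_eq_cl_iff hD₁ u.1 u'.1
  let e : S ⧸ H → Set (Fin 3 → K) := Quotient.lift cl fun u u' huu' => (hcl u u').2 (QuotientGroup.leftRel_apply.1 huu')
  have he_mk : ∀ u : S, e (QuotientGroup.mk u) = cl u := fun u => rfl
  have hbij : Set.BijOn e Set.univ (polarisationNormClasses σ ϖ tv M₀) := by
    refine ⟨fun q _ => ?_, fun q _ q' _ hqq' => ?_, fun C hC => ?_⟩
    · induction q using QuotientGroup.induction_on with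
      | H u => rw [he_mk]; exact (mem_polarisationNormClasses_iff_exists_cl hD₁ hcoset _).2 ⟨u.1, u.2, rfl⟩
    · induction q using QuotientGroup.induction_on with
      | H u =>
        induction q' using QuotientGroup.induction_on with
        | H u' => rw [he_mk, he_mk] at hqq'; exact QuotientGroup.eq.2 ((hcl u u').1 hqq')
    · obtain ⟨u, hu, rfl⟩ := (mem_polarisationNormClasses_iff_exists_cl hD₁ hcoset C).1 hC
      exact ⟨QuotientGroup.mk ⟨u, hu⟩, Set.mem_univ _, rfl⟩
  have hsum : labelledOddCount σ ϖ tv i Λ M₀ = ∑ q : S ⧸ H, classLabelSign σ i (Λ M₀) (e q) := by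
    rw [labelledOddCount_eq, ← finsum_mem_eq_of_bijOn (f := fun q => classLabelSign σ i (Λ M₀) (e q)) e hbij (fun _ _ => rfl),
      finsum_mem_univ, finsum_eq_sum_of_fintype]
  -- the slot character `ω_i : S_F →* ℤ`, the label character `λ : S_F →* ℤ`, and their descent to `A`
  let χ : S →* ℤ :=
    { toFun := fun u => normSign σ ((u.1 i : Kˣ) : K)
      map_one' := by
        show normSign σ ((((1 : S) : Fin 3 → Kˣ) i : Kˣ) : K) = 1
        rw [OneMemClass.coe_one, Pi.one_apply, Units.val_one]; exact normSign_one_eq σ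
      map_mul' := fun u u' => by
        show normSign σ ((((u * u' : S) : Fin 3 → Kˣ) i : Kˣ) : K) = normSign σ ((u.1 i : Kˣ) : K) * normSign σ ((u'.1 i : Kˣ) : K)
        rw [Subgroup.coe_mul, Pi.mul_apply, Units.val_mul]
        exact normSign_mul_of_dichotomy σ hσc hc hdich (hfixS u i).1 (hfixS u' i).1 (hfixS u i).2 (hfixS u' i).2 }
  let χL : S →* ℤ :=
    { toFun := fun u => lam u.1
      map_one' := by
        show lam ((1 : S) : Fin 3 → Kˣ) = 1
        rw [OneMemClass.coe_one]; exact character_one_eq_one hmul hval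
      map_mul' := fun u u' => by
        show lam ((u * u' : S) : Fin 3 → Kˣ) = lam u.1 * lam u'.1
        rw [Subgroup.coe_mul]; exact hmul u.1 u.2 u'.1 u'.2 }
  have hχ_apply : ∀ u : S, χ u = normSign σ ((u.1 i : Kˣ) : K) := fun _ => rfl
  have hχL_apply : ∀ u : S, χL u = lam u.1 := fun _ => rfl
  have hχH : H ≤ χ.ker := fun n hn => by
    rw [MonoidHom.mem_ker, hχ_apply]
    rw [Subgroup.mem_subgroupOf] at hn
    have h1 := normSign_mul_eq_of_mem_map_unitNormMap σ hn 1 i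
    rw [one_mul, normSign_one_eq] at h1
    exact h1
  have hχLH : H ≤ χL.ker := fun n hn => by
    rw [MonoidHom.mem_ker, hχL_apply]
    rw [Subgroup.mem_subgroupOf] at hn
    exact hN n.1 hn
  have hχχH : H ≤ (χ * χL).ker := fun n hn => by
    rw [MonoidHom.mem_ker, MonoidHom.mul_apply, show χ n = 1 from hχH hn, show χL n = 1 from hχLH hn, mul_one]
  let ψ : S ⧸ H →* ℤ := QuotientGroup.lift H χ hχH
  let ψ2 : S ⧸ H →* ℤ := QuotientGroup.lift H (χ * χL) hχχH
  have hψ_mk : ∀ u : S, ψ (QuotientGroup.mk u) = normSign σ ((u.1 i : Kˣ) : K) := fun _ => rfl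
  have hψ2_mk : ∀ u : S, ψ2 (QuotientGroup.mk u) = normSign σ ((u.1 i : Kˣ) : K) * lam u.1 := fun _ => rfl
  -- pointwise: `2·classLabelSign (e q) = ω(D₁ i)·(ψ q + ε·ψ2 q)`
  have hpt : ∀ q : S ⧸ H, 2 * classLabelSign σ i (Λ M₀) (e q) = normSign σ (D₁ i) * (ψ q + ε * ψ2 q) := by
    intro q
    induction q using QuotientGroup.induction_on with
    | H u =>
      rw [he_mk, hψ_mk, hψ2_mk]
      rw [show cl u = {D' : Fin 3 → K | ∃ n ∈ (unitStabilizer M₀).map (unitNormMap σ 3), ∀ j, D' j = D₁ j * ((u.1 j : Kˣ) : K) * ((n j : Kˣ) : K)}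
        from rfl, classLabelSign_cl_eq_of_classSign hσc hc hdich hD₁ hNS Λ i (lam := fun u => ε * lam u) hεlamN hΛ u.2,
        two_mul_ite_eq_mul_one_add (hεval u.1 u.2)]
      ring
  -- the two character sums
  have hS1 : (∑ q : S ⧸ H, ψ q) = if (∀ u ∈ fixedUnitStabilizer σ M₀, normSign σ ((u i : Kˣ) : K) = 1) then ((N'.relIndex S : ℕ) : ℤ) else 0 := by
    have hiff : ψ = 1 ↔ ∀ u ∈ fixedUnitStabilizer σ M₀, normSign σ ((u i : Kˣ) : K) = 1 := by
      refine ⟨fun h u hu => ?_, fun h => ?_⟩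
      · have := DFunLike.congr_fun h (QuotientGroup.mk ⟨u, hu⟩)
        rwa [hψ_mk, MonoidHom.one_apply] at this
      · refine MonoidHom.ext fun q => ?_
        induction q using QuotientGroup.induction_on with
        | H u => rw [hψ_mk, MonoidHom.one_apply]; exact h u.1 u.2
    rw [sum_hom_units ψ, Nat.cast_ite, Nat.cast_zero]
    exact if_congr hiff hcard rfl
  have hS2 : (∑ q : S ⧸ H, ψ2 q) =
      if (∀ u ∈ fixedUnitStabilizer σ M₀, normSign σ ((u i : Kˣ) : K) * lam u = 1) then ((N'.relIndex S : ℕ) : ℤ) else 0 := by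
    have hiff : ψ2 = 1 ↔ ∀ u ∈ fixedUnitStabilizer σ M₀, normSign σ ((u i : Kˣ) : K) * lam u = 1 := by
      refine ⟨fun h u hu => ?_, fun h => ?_⟩
      · have := DFunLike.congr_fun h (QuotientGroup.mk ⟨u, hu⟩)
        rwa [hψ2_mk, MonoidHom.one_apply] at this
      · refine MonoidHom.ext fun q => ?_
        induction q using QuotientGroup.induction_on with
        | H u => rw [hψ2_mk, MonoidHom.one_apply]; exact h u.1 u.2
    rw [sum_hom_units ψ2, Nat.cast_ite, Nat.cast_zero]
    exact if_congr hiff hcard rfl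
  -- assemble
  rw [hsum, Finset.mul_sum, Finset.sum_congr rfl fun q _ => hpt q, ← Finset.mul_sum, Finset.sum_add_distrib, ← Finset.mul_sum, hS1, hS2]
  split_ifs <;> ring

open Classical in
/-- **HEAD A-χ, UNIT NON-NORM FORM** (the scalar stabiliser `(c, c, c) ∈ S_F(M₀)` kills `[ω_i ≡ 1 on S_F]`, ★ g36 `not_forall_normSign_apply_eq_one`):
`2 · labelledOddCount σ ϖ tv i Λ M₀ = ε · ω(D_{1,i}) · |A| · [∀ u ∈ S_F, ω(u_i)·λ(u) = 1]`. [cite: Kottwitz1986BaseChangeUnits, §1 pp. 240–241] [cite: LanglandsShelstad1987, §3] -/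
theorem two_mul_labelledOddCount_eq_of_character_of_unit (hσ : ∀ x, σ (σ x) = x)
    {c : K} (hσc : σ c = c) (hcv : Valued.v c = 1) (hc : ¬ ∃ z : K, z * σ z = c)
    (hdich : ∀ x : K, σ x = x → x ≠ 0 → (∃ z : K, z * σ z = x) ∨ ∃ z : K, z * σ z = c * x)
    (hD₁ : ∀ j, σ (D₁ j) = D₁ j ∧ D₁ j ≠ 0) (hV₁ : IsVertexLattice σ ϖ (Matrix.diagonal D₁) tv M₀)
    (hcoset : ∀ D : Fin 3 → K, (∀ j, σ (D j) = D j ∧ D j ≠ 0) →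
      (IsVertexLattice σ ϖ (Matrix.diagonal D) tv M₀ ↔ ∃ u ∈ fixedUnitStabilizer σ M₀, ∀ j, D j = D₁ j * ((u j : Kˣ) : K)))
    (hA : ((unitStabilizer M₀).map (unitNormMap σ 3)).relIndex (fixedUnitStabilizer σ M₀) ≠ 0)
    (Λ : Submodule 𝒪[K] (Fin 3 → K) → (Fin 3 → K) → Prop) (i : Fin 3) {ε : ℤ} (hε : ε = 1 ∨ ε = -1)
    {lam : (Fin 3 → Kˣ) → ℤ} (hmul : ∀ u ∈ fixedUnitStabilizer σ M₀, ∀ u' ∈ fixedUnitStabilizer σ M₀, lam (u * u') = lam u * lam u')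
    (hval : ∀ u ∈ fixedUnitStabilizer σ M₀, lam u = 1 ∨ lam u = -1)
    (hN : ∀ n ∈ (unitStabilizer M₀).map (unitNormMap σ 3), lam n = 1)
    (hΛ : ∀ u ∈ fixedUnitStabilizer σ M₀, Λ M₀ (fun j => D₁ j * ((u j : Kˣ) : K)) ↔ ε * lam u = 1) :
    2 * labelledOddCount σ ϖ tv i Λ M₀ =
      ε * normSign σ (D₁ i) * ((((unitStabilizer M₀).map (unitNormMap σ 3)).relIndex (fixedUnitStabilizer σ M₀) : ℕ) : ℤ) *
        (if ∀ u ∈ fixedUnitStabilizer σ M₀, normSign σ ((u i : Kˣ) : K) * lam u = 1 then 1 else 0) := by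
  rw [two_mul_labelledOddCount_eq_of_character hσ hσc hc hdich hD₁ hV₁ hcoset hA Λ i hε hmul hval hN hΛ,
    if_neg (not_forall_normSign_apply_eq_one σ M₀ hσc hcv hc i)]
  ring

/-! ## §2  HEAD A′-χ — the per-orbit term over `ℚ` -/

open Classical in
/-- **HEAD A′-χ — THE PER-ORBIT TERM OF THE LABELLED STAGE A ON A CHARACTER-LABEL ORBIT** (over `ℚ`, on a finite unit-torus orbit; `[𝒰 : N(S̃′)] = |A|·[𝒰 : S_F]` by the tower):
`labelledOddCount σ ϖ tv i Λ M₀ ∕ [𝒰 : N(S̃′(M₀))] = ε·ω(D_{1,i})∕2 · [∀ u ∈ S_F, ω(u_i)·λ(u) = 1] · stabiliserWeight σ M₀`.  ★ g36 HEAD A′ is the case `λ = ω(u_k)`.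
[cite: Kottwitz1986BaseChangeUnits, §1 pp. 240–241] [cite: LanglandsShelstad1987, §3] [cite: Rogawski1990, §4.9 Prop. 4.9.1 (a)(b) p. 55] -/
theorem labelledOddCount_div_relIndex_eq_of_character (hσ : ∀ x, σ (σ x) = x) (hvσ : ∀ a, Valued.v (σ a) = Valued.v a)
    {c : K} (hσc : σ c = c) (hcv : Valued.v c = 1) (hc : ¬ ∃ z : K, z * σ z = c)
    (hdich : ∀ x : K, σ x = x → x ≠ 0 → (∃ z : K, z * σ z = x) ∨ ∃ z : K, z * σ z = c * x)
    (hfin : {M : Submodule 𝒪[K] (Fin 3 → K) | ∃ u ∈ unitTorus K 3, M = mapGL (diagGLUnits u) M₀}.Finite)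
    (hD₁ : ∀ j, σ (D₁ j) = D₁ j ∧ D₁ j ≠ 0) (hV₁ : IsVertexLattice σ ϖ (Matrix.diagonal D₁) tv M₀)
    (hcoset : ∀ D : Fin 3 → K, (∀ j, σ (D j) = D j ∧ D j ≠ 0) →
      (IsVertexLattice σ ϖ (Matrix.diagonal D) tv M₀ ↔ ∃ u ∈ fixedUnitStabilizer σ M₀, ∀ j, D j = D₁ j * ((u j : Kˣ) : K)))
    (Λ : Submodule 𝒪[K] (Fin 3 → K) → (Fin 3 → K) → Prop) (i : Fin 3) {ε : ℤ} (hε : ε = 1 ∨ ε = -1)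
    {lam : (Fin 3 → Kˣ) → ℤ} (hmul : ∀ u ∈ fixedUnitStabilizer σ M₀, ∀ u' ∈ fixedUnitStabilizer σ M₀, lam (u * u') = lam u * lam u')
    (hval : ∀ u ∈ fixedUnitStabilizer σ M₀, lam u = 1 ∨ lam u = -1)
    (hN : ∀ n ∈ (unitStabilizer M₀).map (unitNormMap σ 3), lam n = 1)
    (hΛ : ∀ u ∈ fixedUnitStabilizer σ M₀, Λ M₀ (fun j => D₁ j * ((u j : Kˣ) : K)) ↔ ε * lam u = 1) :
    (labelledOddCount σ ϖ tv i Λ M₀ : ℚ) / ((((unitStabilizer M₀).map (unitNormMap σ 3)).relIndex (fixedUnitTorus σ 3) : ℕ) : ℚ) =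
      (ε : ℚ) * (normSign σ (D₁ i) : ℚ) / 2 *
        ((if ∀ u ∈ fixedUnitStabilizer σ M₀, normSign σ ((u i : Kˣ) : K) * lam u = 1 then 1 else 0 : ℤ) : ℚ) * stabiliserWeight σ M₀ := by
  classical
  set S := fixedUnitStabilizer σ M₀ with hSdef
  set N' := (unitStabilizer M₀).map (unitNormMap σ 3) with hN'def
  have hNS : N' ≤ S := map_unitNormMap_unitStabilizer_le σ hσ ϖ tv hD₁ hV₁ hcoset
  have hSU : S ≤ fixedUnitTorus σ 3 := inf_le_right
  have hUN : N'.relIndex (fixedUnitTorus σ 3) ≠ 0 := relIndex_map_unitNormMap_unitStabilizer_ne_zero hσ hvσ hσc hcv hc hdich hfin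
  have htower : N'.relIndex S * S.relIndex (fixedUnitTorus σ 3) = N'.relIndex (fixedUnitTorus σ 3) := Subgroup.relIndex_mul_relIndex N' S _ hNS hSU
  have hA : N'.relIndex S ≠ 0 := fun h => hUN (by rw [← htower, h, zero_mul])
  have hSF : S.relIndex (fixedUnitTorus σ 3) ≠ 0 := relIndex_fixedUnitStabilizer_ne_zero_of_finite σ hfin
  have h2 := two_mul_labelledOddCount_eq_of_character_of_unit hσ hσc hcv hc hdich hD₁ hV₁ hcoset hA Λ i hε hmul hval hN hΛ
  have h2Q : (2 : ℚ) * (labelledOddCount σ ϖ tv i Λ M₀ : ℚ) = (ε : ℚ) * (normSign σ (D₁ i) : ℚ) * ((N'.relIndex S : ℕ) : ℚ) *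
      ((if ∀ u ∈ fixedUnitStabilizer σ M₀, normSign σ ((u i : Kˣ) : K) * lam u = 1 then 1 else 0 : ℤ) : ℚ) := by
    exact_mod_cast h2
  have hA' : ((N'.relIndex S : ℕ) : ℚ) ≠ 0 := Nat.cast_ne_zero.2 hA
  have hSF' : ((S.relIndex (fixedUnitTorus σ 3) : ℕ) : ℚ) ≠ 0 := Nat.cast_ne_zero.2 hSF
  have hL : (labelledOddCount σ ϖ tv i Λ M₀ : ℚ) = (ε : ℚ) * (normSign σ (D₁ i) : ℚ) * ((N'.relIndex S : ℕ) : ℚ) *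
      ((if ∀ u ∈ fixedUnitStabilizer σ M₀, normSign σ ((u i : Kˣ) : K) * lam u = 1 then 1 else 0 : ℤ) : ℚ) / 2 := by
    linarith
  rw [hL, stabiliserWeight, ← hSdef, ← htower, Nat.cast_mul]
  field_simp

end Summit.HodgeConjecture.HodgeConjecture.Cruxes.H413.F0P3cDyRamLabelledOddCharacterRead

end
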